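import Summits.ResolutionOfSingularities.ResolutionOfSingularities.Theorems.WeightedInvariantLocalWeightedDropTameLift

/-!
# The tame residual T″ of skeleton v28 IS the coefficient-tuple game one dimension down

[OURS · L1 W4.3 · chain w43, SEAT TABLE v6.1 row stub-4 «W4/T″ at N = 4 with strat-1»; stub worker 4] Engine crux
`LocalWeightedDrop` (stmt-ResolutionOfSingularities-8899), registered skeleton v28 (b8b73808bd522080), residual stub T″
`stub_tameWideApexHigherStartsWon` (tame: `p ∤ ord f`, `N = n + 4 ≥ 4`) and its `N = 4` instance
`ResidualSplit.stub_tameWideApexFourStartsWon` (res-L1-w43-strat-1, residuals_split_v1.lean, evidence #44 on stmt-8899).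
NOT a statement of any manuscript; the games are the programme's own.

By the landed tame-multiplicity lift `TameLift.preparedWon_of_drop` (Tschirnhaus form ∘ `stub_multiplicityLift`, every
dimension), T″ needs NONE of its cone hypotheses: it follows — statement VERBATIM — from the coefficient-tuple game
`TupleGame.Drop k m e` (order reduction of Hironaka's marked coefficient ideal `(a_j, e + 2 - j)_j` on `k⟦x_0,…,x_{m-1}⟧`
in positional form, `Literature/…/CobordantTupleGame.lean`) in the dimensions `m ≥ 3`:

* `tameWideApexHigherStartsWon_of_tupleDrop` — `(∀ m ≥ 3, ∀ e, Drop k m e) → T″` (v28 signature verbatim);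
* `tameWideApexFourStartsWon_of_tupleDrop` — `(∀ e, Drop k 3 e) → T″ at N = 4` (strat-1's `stub_tameWideApexFourStartsWon`
  signature verbatim): the tame threefold-hypersurface residual is EXACTLY the tuple game on `k⟦x₀,x₁,x₂⟧`, i.e. embedded
  resolution of idealistic exponents on the regular local threefold `Spec k⟦x₀,x₁,x₂⟧` in the game's positional form
  (printed neighbours: Cossart–Piltant 2008 Prop. 4.4 = `Resolution.CossartPiltant2008_prop44` for `dim V(J) ≤ 1`;
  Cossart–Jannsen–Saito 2020 for the divisorial part; the plane case `Drop k 2 e` is the landed `TameLift.tupleDropPlane`).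

Proofs of the item WITH EXTRA HYPOTHESES; nothing is closed by name.
-/

set_option linter.dupNamespace false -- mandated namespace of this single-conjunct summit

namespace Summit.ResolutionOfSingularities.ResolutionOfSingularities.Theorems

open Literature.AlgebraicGeometry.Resolution
open Literature.AlgebraicGeometry.Resolution.CobordantGame

namespace TameLift

/-- A singular germ has order `e + 2` for some `e`. [OURS · folklore] -/
theorem exists_order_eq_add_two {k : Type} [Field k] {N : ℕ} {f : MvPowerSeries (Fin N) k} (hf : IsSingular k f)
    {d : ℕ} (hfd : f.order = d) : ∃ e : ℕ, d = e + 2 := by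
  have h2 : (2 : ℕ∞) ≤ f.order := (FormalCoordChange.two_le_order_iff f).mpr hf.2
  rw [hfd] at h2
  exact ⟨d - 2, by have : 2 ≤ d := (by exact_mod_cast h2); omega⟩

/-- TAME GERMS OF ORDER `d` IN `m + 1 ≥ 2` VARIABLES ARE WON from the tuple game `Drop k m (d - 2)` and the singular germs
of smaller order (repackaging of `preparedWon_of_drop` with `d` free). [OURS · L1 W4.3] -/
theorem tameWon_of_tupleDrop (p : ℕ) (hp : p.Prime) (k : Type) [Field k] [CharP k p] [IsAlgClosed k] (m : ℕ)
    (hdrop : ∀ e : ℕ, TupleGame.Drop k m e) (f : MvPowerSeries (Fin (m + 1)) k) (hf : IsSingular k f)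
    (hord : ∀ g : MvPowerSeries (Fin (m + 1)) k, IsSingular k g → g.order < f.order → Won k (m + 1) g)
    (d : ℕ) (hfd : f.order = d) (hpd : ¬ p ∣ d) : Won k (m + 1) f := by
  obtain ⟨e, rfl⟩ := exists_order_eq_add_two hf hfd
  exact preparedWon_of_drop p hp k m e (hdrop e) (fun G hG hlt => hord G hG (by rw [hfd]; exact hlt)) f hf hfd hpd

end TameLift

/-- **T″ FROM THE TUPLE GAME IN DIMENSIONS `≥ 3`** (v28 signature of `stub_tameWideApexHigherStartsWon` VERBATIM as the
conclusion): if the coefficient-tuple game `TupleGame.Drop k m e` is won for every `m ≥ 3` and every `e`, the tame wide-apex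
residual core holds — none of its cone hypotheses is needed. [OURS · L1 W4.3; proof of the stub WITH AN EXTRA HYPOTHESIS] -/
theorem tameWideApexHigherStartsWon_of_tupleDrop
    (hdrop : ∀ (p : ℕ), p.Prime → ∀ (k : Type) [Field k] [CharP k p] [IsAlgClosed k] (m e : ℕ), 3 ≤ m →
      TupleGame.Drop k m e) :
    ∀ (p : ℕ), p.Prime → ∀ (k : Type) [Field k] [CharP k p] [IsAlgClosed k]
    (n : ℕ), (∀ m : ℕ, m < n + 4 → ∀ g : MvPowerSeries (Fin m) k,
      CobordantGame.IsSingular k g → CobordantGame.Won k m g) →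
    ∀ (f : MvPowerSeries (Fin (n + 4)) k), CobordantGame.IsSingular k f →
    (∀ g : MvPowerSeries (Fin (n + 4)) k, CobordantGame.IsSingular k g → g.order < f.order →
      CobordantGame.Won k (n + 4) g) →
    ∀ (d : ℕ), f.order = d → ¬ p ∣ d →
    (∃ ℓ : Fin (n + 4) → k, ∀ i j : Fin (n + 4),
      MvPowerSeries.coeff (Finsupp.single i 1 + Finsupp.single j 1) f =
        MvPowerSeries.coeff (Finsupp.single i 1 + Finsupp.single j 1)
          ((∑ l, MvPowerSeries.C (ℓ l) * MvPowerSeries.X l) ^ 2)) →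
    (2 < d → ∃ c₁ c₂ : Fin (n + 4) → k, (∀ α β : k, α • c₁ + β • c₂ = 0 → α = 0 ∧ β = 0) ∧
      (∀ v : Fin (n + 4) → k, CobordantChart.initEval (fun _ : Fin (n + 4) => 1) (v + c₁) d f =
        CobordantChart.initEval (fun _ : Fin (n + 4) => 1) v d f) ∧
      (∀ v : Fin (n + 4) → k, CobordantChart.initEval (fun _ : Fin (n + 4) => 1) (v + c₂) d f =
        CobordantChart.initEval (fun _ : Fin (n + 4) => 1) v d f)) →
    CobordantGame.Won k (n + 4) f :=
  fun p hp k _ _ _ n _ f hf hord d hfd hpd _ _ =>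
    TameLift.tameWon_of_tupleDrop p hp k (n + 3) (fun e => hdrop p hp k (n + 3) e (by omega)) f hf hord d hfd hpd

/-- **T″ AT `N = 4` FROM THE TUPLE GAME ON `k⟦x₀,x₁,x₂⟧`** (signature of res-L1-w43-strat-1's
`ResidualSplit.stub_tameWideApexFourStartsWon` VERBATIM as the conclusion): the tame threefold-hypersurface residual of
the engine is the coefficient-tuple game in three variables (`∀ e, TupleGame.Drop k 3 e`), i.e. positional embedded
resolution of idealistic exponents on the regular local threefold `Spec k⟦x₀,x₁,x₂⟧`. [OURS · L1 W4.3; proof of the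
sub-stub WITH AN EXTRA HYPOTHESIS] -/
theorem tameWideApexFourStartsWon_of_tupleDrop
    (hdrop : ∀ (p : ℕ), p.Prime → ∀ (k : Type) [Field k] [CharP k p] [IsAlgClosed k] (e : ℕ), TupleGame.Drop k 3 e) :
    ∀ (p : ℕ), p.Prime → ∀ (k : Type) [Field k] [CharP k p] [IsAlgClosed k],
    (∀ m : ℕ, m < 4 → ∀ g : MvPowerSeries (Fin m) k,
      CobordantGame.IsSingular k g → CobordantGame.Won k m g) →
    ∀ (f : MvPowerSeries (Fin 4) k), CobordantGame.IsSingular k f →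
    (∀ g : MvPowerSeries (Fin 4) k, CobordantGame.IsSingular k g → g.order < f.order →
      CobordantGame.Won k 4 g) →
    ∀ (d : ℕ), f.order = d → ¬ p ∣ d →
    (∃ ℓ : Fin 4 → k, ∀ i j : Fin 4,
      MvPowerSeries.coeff (Finsupp.single i 1 + Finsupp.single j 1) f =
        MvPowerSeries.coeff (Finsupp.single i 1 + Finsupp.single j 1)
          ((∑ l, MvPowerSeries.C (ℓ l) * MvPowerSeries.X l) ^ 2)) →
    (2 < d → ∃ c₁ c₂ : Fin 4 → k, (∀ α β : k, α • c₁ + β • c₂ = 0 → α = 0 ∧ β = 0) ∧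
      (∀ v : Fin 4 → k, CobordantChart.initEval (fun _ : Fin 4 => 1) (v + c₁) d f =
        CobordantChart.initEval (fun _ : Fin 4 => 1) v d f) ∧
      (∀ v : Fin 4 → k, CobordantChart.initEval (fun _ : Fin 4 => 1) (v + c₂) d f =
        CobordantChart.initEval (fun _ : Fin 4 => 1) v d f)) →
    CobordantGame.Won k 4 f :=
  fun p hp k _ _ _ _ f hf hord d hfd hpd _ _ =>
    TameLift.tameWon_of_tupleDrop p hp k 3 (fun e => hdrop p hp k e) f hf hord d hfd hpd

/-- **EVERY TAME SINGULAR GERM IN `N ≥ 2` VARIABLES IS WON from the tuple games in dimensions `< N` and the germs of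
smaller order** — the dimension-uniform form (no cone hypotheses, no residue on `N`). [OURS · L1 W4.3] -/
theorem tameGermWon_of_tupleDrop (p : ℕ) (hp : p.Prime) (k : Type) [Field k] [CharP k p] [IsAlgClosed k] (N : ℕ)
    (hN : 1 ≤ N) (hdrop : ∀ e : ℕ, TupleGame.Drop k (N - 1) e) (f : MvPowerSeries (Fin N) k) (hf : IsSingular k f)
    (hord : ∀ g : MvPowerSeries (Fin N) k, IsSingular k g → g.order < f.order → Won k N g)
    (d : ℕ) (hfd : f.order = d) (hpd : ¬ p ∣ d) : Won k N f := by
  obtain ⟨m, rfl⟩ : ∃ m, N = m + 1 := ⟨N - 1, by omega⟩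
  exact TameLift.tameWon_of_tupleDrop p hp k m (by simpa using hdrop) f hf hord d hfd hpd

end Summit.ResolutionOfSingularities.ResolutionOfSingularities.Theorems
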